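import Summits.QuantumFields.YangMills.Theorems.UnitScaleTiltMinimiserStabilityRegPrAvgCurvGrad
import Summits.QuantumFields.YangMills.Theorems.UnitScaleTiltProp7ExpLipschitz
import Literature.MathematicalPhysics.QuantumFieldTheory.Balaban1983to89.T4AdjointCovarianceUnitary
import HarnessLib

/-!
# Route `UnitScaleTilt`, crux K1 child «MinimiserStabilityRegPr» (stmt-QuantumFields-19200), registered stub `stub_prop7From14` (skeleton birth_v7
# cc37a178…; leaf V3) — pillar P-V3-CDE, row (D), divergence clause, ALGEBRA: the plaquette field of `U₁U₀` factors through the background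
# plaquette ([Balaban1985BackgroundPropagators] (3.1)–(3.2)), its backward covariant derivative at `U₁U₀` versus at `U₀`, the transported exponents
# `Z₁…Z₄` of [Balaban1985RegularSpaces] (1.47), and THEIR COVARIANT DIFFERENCES between neighbouring plaquettes bounded by the (19) gradients and
# the background's plaquettes

Cell `ym3-torus`, width seat `ym-ust-19200-w2` (gen 0; OWNER RULING g24-№1 A2′: v8 row (D)).  YM₃ on T³ is a ladder rung (R3), not the Clay problem; nothing
here is a claim about the crux, d = 4 or the mass gap.

WHY.  `Prop7PV3CDERowD` reduced row (D) to the estimate «`U₁` in (19) at `ε₂` over `U₀ ∈ 𝔘_k(a)` ⇒ `D*`-clause of (2) for `U₁U₀` at radius `O(ε₂)`»; its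
plaquette half is `Prop7B8Prop7Plaq`.  For the divergence half the second-order remainder of (1.47) (size `O(ε₂²η²)`) must be DIFFERENCED covariantly
between the plaquettes at `x − e_ν` and `x`; this file supplies the exact identities and the four «transport» estimates
`‖Ad(U₀(x−e_ν,x))Zⱼ(x − e_ν) − Zⱼ(x)‖ ≤ |∇X| + 2|U₀(∂p) − 1|·|X|` that make the difference `O(ε₂η²)·O(ε₂η)`.

WHAT IS PROVED (sorry-free, no definition; `SU(2)` read in `M₂(ℂ)`).
§1 `holT_plaqWord_emb15` — `(U₁U₀)(∂p) = Φ·U₀(∂p)` with `Φ = W₁·Ad(V₁)W₂·Ad(U₀(∂p))[Ad(V₄)W₃⁻¹·W₄⁻¹]` (group identity; `Wᵢ = U₁(bᵢ)`, `Vᵢ = U₀(bᵢ)`).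
§2 `covDerivT_plaqFT_bg_eq`, `covDerivT_plaqFT_emb15_eq`, `covDerivT_bg_apply`, `covCurlT_bg_eq` — the letters of [6] (1.1)–(1.2) in matrices;
   `coe_phiFlat_eq_exp4` — `Ad`-transported fluctuations are exponentials of the transported exponents `Z₂ = Ad(V₁)X₂`, `Z₃ = Ad(V₄)X₃`;
   `conj_plaq4_eq` — `Ad(w⁻¹)` commutes with the four-factor function of `Prop7ExpLipschitz`.
§3 `norm_holT_plaqWord_sub_one_lt` — `|U₀(∂(x; κ, μ)) − 1| < aη²` for ALL index pairs from `PlaqSmall`; the transport estimates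
   `norm_transport_Z1_sub_le`, `…Z4…`, `…Z2…`, `…Z3…`.

HONEST SCOPE.  Identities and elementary estimates; the divergence-clause theorem itself is the next file.  Count-neutral helper toward
stmt-QuantumFields-19200 (`--supports`), not a proof of the stub.

References: T. Bałaban, CMP 99 (1985) 75–102 [Balaban1985RegularSpaces] ((1.1)–(1.2) p.76, (1.47) p.84, Prop. 7 p.98); CMP 99 (1985) 389–434
[Balaban1985BackgroundPropagators] ((3.1)–(3.4) pp.390–391); CMP 102 (1985) 277–309 [Balaban1985Variational] ((19) p.281, (2) p.278).
-/

noncomputable section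

namespace Summit.QuantumFields.YangMills.Theorems.Prop7B8Prop7DivAlg

open Literature.MathematicalPhysics.QuantumFieldTheory.Balaban1983to89
open B10Eq27TorusAxialLog (toUField unitsField unitsField_mem_unitaryUnits val_unitsField holT holT_plaqWord holT_plaqWord_eq_plaqHol
  holT_plaqWord_swap)
open B10Eq68TorusRegularity (plaqFT covDerivT)
open B7Prop1Explicit (plaqWord)
open B7Eq78Linearization (conjR conjR_apply)
open T3SectALandauChart
open Summit.QuantumFields.YangMills.Theorems.AvgCurvGrad (plaqFT_toUField val_unitsField_toUField val_unitsField_toUField_inv)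
open Summit.QuantumFields.YangMills.Theorems.Prop7CovariantCoercivity (coe_inv_eq_star norm_conj_sub_self_le')
open NormedSpace

open scoped Matrix.Norms.L2Operator

variable {P : Params} {s : ℕ}

/-! ## §1 The plaquette of `U₁U₀` through the background plaquette (group identity) -/

/-- **[Balaban1985BackgroundPropagators] (3.1)–(3.2) FOR THE PLAQUETTE WORD**: with `Π = U₀(∂(x; α, β))`, `Wᵢ = U₁(bᵢ)`, `Vᵢ = U₀(bᵢ)` on the bonds
`b₁ = ⟨x,α⟩`, `b₂ = ⟨x+e_α,β⟩`, `b₃ = ⟨x+e_β,α⟩`, `b₄ = ⟨x,β⟩`: `(U₁U₀)(∂(x; α, β)) = [W₁ · V₁W₂V₁⁻¹ · Π(V₄W₃V₄⁻¹)⁻¹W₄⁻¹Π⁻¹] · Π`.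
[cite: Balaban1985BackgroundPropagators, (3.1)-(3.2) p.390] -/
theorem holT_plaqWord_emb15 {F : T3ContinuumYM3Torus.T3Family} {K : ℕ}
    (U₀ U₁ : GaugeField (F.P K) 0 (Matrix.specialUnitaryGroup (Fin 2) ℂ)) (x : Site (F.P K) 0) (α β : Fin (F.P K).d) :
    holT (emb15 U₀ U₁) x (plaqWord α β)
      = (U₁ ⟨x, α⟩ * (U₀ ⟨x, α⟩ * U₁ ⟨x.shift α, β⟩ * (U₀ ⟨x, α⟩)⁻¹)
          * (holT U₀ x (plaqWord α β) * ((U₀ ⟨x, β⟩ * U₁ ⟨x.shift β, α⟩ * (U₀ ⟨x, β⟩)⁻¹)⁻¹ * (U₁ ⟨x, β⟩)⁻¹) * (holT U₀ x (plaqWord α β))⁻¹))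
        * holT U₀ x (plaqWord α β) := by
  rw [holT_plaqWord, holT_plaqWord]
  show U₁ ⟨x, α⟩ * U₀ ⟨x, α⟩ * (U₁ ⟨x.shift α, β⟩ * U₀ ⟨x.shift α, β⟩) * (U₁ ⟨x.shift β, α⟩ * U₀ ⟨x.shift β, α⟩)⁻¹
      * (U₁ ⟨x, β⟩ * U₀ ⟨x, β⟩)⁻¹ = _
  group

/-! ## §2 The letters of [6] (1.1)–(1.2) in matrices, for a background and for `U₁U₀` -/

section Letters

variable {F : T3ContinuumYM3Torus.T3Family} {K : ℕ}

/-- `↑((U₀ b)⁻¹) = U₀(b)^*` in `M₂(ℂ)` (local copy of a `rfl` lemma, cf. `CrossoverCertificate.Negative.su2_coe_inv`). [folklore] -/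
private theorem coe_su_inv (g : Matrix.specialUnitaryGroup (Fin 2) ℂ) :
    ((g⁻¹ : Matrix.specialUnitaryGroup (Fin 2) ℂ) : Matrix (Fin 2) (Fin 2) ℂ) = star (g : Matrix (Fin 2) (Fin 2) ℂ) := rfl

/-- **(1.1) FOR THE BACKGROUND'S PLAQUETTE FIELD**: `(D^{1*}_{U₀,ν}∂U₀_{αβ})(x) = U₀(x′,ν)^*·U₀(∂(x′;α,β))·U₀(x′,ν) − U₀(∂(x;α,β))`, `x′ = x − e_ν`.
[cite: Balaban1985RegularSpaces, (1.1)-(1.2) p.76] -/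
theorem covDerivT_plaqFT_bg_eq (U₀ : GaugeField (F.P K) 0 (Matrix.specialUnitaryGroup (Fin 2) ℂ)) (ν α β : Fin (F.P K).d) (x : Site (F.P K) 0) :
    covDerivT 1 (bgUnits F K U₀) ν (plaqFT (bgUnits F K U₀) α β) x
      = star ((U₀ ⟨x.unshift ν, ν⟩ : Matrix.specialUnitaryGroup (Fin 2) ℂ) : Matrix (Fin 2) (Fin 2) ℂ)
          * ((holT U₀ (x.unshift ν) (plaqWord α β) : Matrix.specialUnitaryGroup (Fin 2) ℂ) : Matrix (Fin 2) (Fin 2) ℂ)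
          * ((U₀ ⟨x.unshift ν, ν⟩ : Matrix.specialUnitaryGroup (Fin 2) ℂ) : Matrix (Fin 2) (Fin 2) ℂ)
        - ((holT U₀ x (plaqWord α β) : Matrix.specialUnitaryGroup (Fin 2) ℂ) : Matrix (Fin 2) (Fin 2) ℂ) := by
  unfold covDerivT bgUnits
  rw [inv_one, one_smul, conjR_apply, inv_inv, plaqFT_toUField, plaqFT_toUField, val_unitsField_toUField_inv, val_unitsField_toUField, coe_su_inv]

/-- **(1.1) FOR THE PLAQUETTE FIELD OF `U₁U₀`**: the same with the bond variable `U₁(x′,ν)U₀(x′,ν)` and the plaquettes of `U₁U₀`.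
[cite: Balaban1985RegularSpaces, (1.1)-(1.2) p.76; Balaban1985Variational, (15) p.280] -/
theorem covDerivT_plaqFT_emb15_eq (U₀ U₁ : GaugeField (F.P K) 0 (Matrix.specialUnitaryGroup (Fin 2) ℂ)) (ν α β : Fin (F.P K).d) (x : Site (F.P K) 0) :
    covDerivT 1 (bgUnits F K (emb15 U₀ U₁)) ν (plaqFT (bgUnits F K (emb15 U₀ U₁)) α β) x
      = star ((U₀ ⟨x.unshift ν, ν⟩ : Matrix.specialUnitaryGroup (Fin 2) ℂ) : Matrix (Fin 2) (Fin 2) ℂ)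
          * star ((U₁ ⟨x.unshift ν, ν⟩ : Matrix.specialUnitaryGroup (Fin 2) ℂ) : Matrix (Fin 2) (Fin 2) ℂ)
          * ((holT (emb15 U₀ U₁) (x.unshift ν) (plaqWord α β) : Matrix.specialUnitaryGroup (Fin 2) ℂ) : Matrix (Fin 2) (Fin 2) ℂ)
          * (((U₁ ⟨x.unshift ν, ν⟩ : Matrix.specialUnitaryGroup (Fin 2) ℂ) : Matrix (Fin 2) (Fin 2) ℂ)
              * ((U₀ ⟨x.unshift ν, ν⟩ : Matrix.specialUnitaryGroup (Fin 2) ℂ) : Matrix (Fin 2) (Fin 2) ℂ))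
        - ((holT (emb15 U₀ U₁) x (plaqWord α β) : Matrix.specialUnitaryGroup (Fin 2) ℂ) : Matrix (Fin 2) (Fin 2) ℂ) := by
  unfold covDerivT bgUnits
  rw [inv_one, one_smul, conjR_apply, inv_inv, plaqFT_toUField, plaqFT_toUField, val_unitsField_toUField_inv, val_unitsField_toUField, coe_su_inv]
  show star ((U₁ ⟨x.unshift ν, ν⟩ * U₀ ⟨x.unshift ν, ν⟩ : Matrix.specialUnitaryGroup (Fin 2) ℂ) : Matrix (Fin 2) (Fin 2) ℂ) * _ *
      ((U₁ ⟨x.unshift ν, ν⟩ * U₀ ⟨x.unshift ν, ν⟩ : Matrix.specialUnitaryGroup (Fin 2) ℂ) : Matrix (Fin 2) (Fin 2) ℂ) - _ = _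
  rw [Submonoid.coe_mul, star_mul]

/-- **(1.1) FOR A MATRIX-VALUED PLAQUETTE FUNCTION** at the background (the curl of the exponent): `(D^{1*}_{U₀,ν}G)(x) = U₀(x′,ν)^*G(x′)U₀(x′,ν) − G(x)`.
[cite: Balaban1985RegularSpaces, (1.1) p.76] -/
theorem covDerivT_bg_apply (U₀ : GaugeField (F.P K) 0 (Matrix.specialUnitaryGroup (Fin 2) ℂ)) (ν : Fin (F.P K).d) (G : Site (F.P K) 0 → Matrix (Fin 2) (Fin 2) ℂ)
    (x : Site (F.P K) 0) :
    covDerivT 1 (bgUnits F K U₀) ν G x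
      = star ((U₀ ⟨x.unshift ν, ν⟩ : Matrix.specialUnitaryGroup (Fin 2) ℂ) : Matrix (Fin 2) (Fin 2) ℂ) * G (x.unshift ν)
          * ((U₀ ⟨x.unshift ν, ν⟩ : Matrix.specialUnitaryGroup (Fin 2) ℂ) : Matrix (Fin 2) (Fin 2) ℂ) - G x := by
  unfold covDerivT bgUnits
  rw [inv_one, one_smul, conjR_apply, inv_inv, val_unitsField_toUField_inv, val_unitsField_toUField, coe_su_inv]

/-- **THE COVARIANT CURL IN MATRICES**: `(D¹_{U₀}X)(∂(y; α, β)) = X₁ + V₁X₂V₁^* − V₄X₃V₄^* − X₄` (`Prop7B8Prop7Plaq.covGradT_one_bgUnits_eq` twice).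
[cite: Balaban1985RegularSpaces, (1.47) p.84; Balaban1985BackgroundPropagators, (3.4) p.391] -/
theorem covCurlT_bg_eq (U₀ : GaugeField (F.P K) 0 (Matrix.specialUnitaryGroup (Fin 2) ℂ)) (X : PBond (F.P K) 0 → Matrix (Fin 2) (Fin 2) ℂ)
    (α β : Fin (F.P K).d) (y : Site (F.P K) 0) :
    covCurlT 1 (bgUnits F K U₀) X α β y
      = X ⟨y, α⟩ + ((U₀ ⟨y, α⟩ : Matrix.specialUnitaryGroup (Fin 2) ℂ) : Matrix (Fin 2) (Fin 2) ℂ) * X ⟨y.shift α, β⟩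
            * star ((U₀ ⟨y, α⟩ : Matrix.specialUnitaryGroup (Fin 2) ℂ) : Matrix (Fin 2) (Fin 2) ℂ)
        - ((U₀ ⟨y, β⟩ : Matrix.specialUnitaryGroup (Fin 2) ℂ) : Matrix (Fin 2) (Fin 2) ℂ) * X ⟨y.shift β, α⟩
            * star ((U₀ ⟨y, β⟩ : Matrix.specialUnitaryGroup (Fin 2) ℂ) : Matrix (Fin 2) (Fin 2) ℂ) - X ⟨y, β⟩ := by
  rw [covCurlT, Prop7B8Prop7Plaq.covGradT_one_bgUnits_eq, Prop7B8Prop7Plaq.covGradT_one_bgUnits_eq]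
  abel

/-- Conjugating `e^{iX}` by a special unitary `v`: `v e^{iX} v^* = e^{i vXv^*}`. [cite: Balaban1985BackgroundPropagators, (3.29) p.395] -/
theorem conj_exp_I_smul (v : Matrix.specialUnitaryGroup (Fin 2) ℂ) (X : Matrix (Fin 2) (Fin 2) ℂ) :
    (v : Matrix (Fin 2) (Fin 2) ℂ) * exp (Complex.I • X) * star (v : Matrix (Fin 2) (Fin 2) ℂ)
      = exp (Complex.I • ((v : Matrix (Fin 2) (Fin 2) ℂ) * X * star (v : Matrix (Fin 2) (Fin 2) ℂ))) := by
  have h := T4AdjointCovarianceUnitary.exp_conj_unitary ⟨(v : Matrix (Fin 2) (Fin 2) ℂ), v.2.1⟩ (Complex.I • X)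
  rw [mul_smul_comm, smul_mul_assoc] at h
  exact h.symm

/-- `(e^{iX})^* = e^{−iX}` for Hermitian `X`. [cite: Balaban1985Averaging, (24) p.21] -/
theorem star_exp_I_smul {X : Matrix (Fin 2) (Fin 2) ℂ} (hX : X.IsHermitian) : star (exp (Complex.I • X)) = exp (Complex.I • (-X)) := by
  rw [star_exp, star_smul, Complex.star_def, Complex.conj_I, Matrix.star_eq_conjTranspose, hX.eq, smul_neg, neg_smul]

/-- **THE «FLAT» FOUR-FACTOR PRODUCT IS THE EXPONENTIAL PRODUCT OF THE TRANSPORTED EXPONENTS**: for `U₁ = e^{iX}` (bondwise, Hermitian `X`),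
`W₁ · V₁W₂V₁⁻¹ · (V₄W₃V₄⁻¹)⁻¹ · W₄⁻¹ = e^{iZ₁}e^{iZ₂}e^{−iZ₃}e^{−iZ₄}` with `Z₁ = X₁`, `Z₂ = V₁X₂V₁^*`, `Z₃ = V₄X₃V₄^*`, `Z₄ = X₄` — the factors of
[Balaban1985RegularSpaces] (1.47). [cite: Balaban1985RegularSpaces, (1.47) p.84] -/
theorem coe_phiFlat_eq_exp4 {U₁ : GaugeField (F.P K) 0 (Matrix.specialUnitaryGroup (Fin 2) ℂ)} {X : PBond (F.P K) 0 → Matrix (Fin 2) (Fin 2) ℂ}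
    (hX : ∀ b, (X b).IsHermitian ∧ Matrix.trace (X b) = 0)
    (hU₁ : ∀ b, ((U₁ b : Matrix.specialUnitaryGroup (Fin 2) ℂ) : Matrix (Fin 2) (Fin 2) ℂ) = exp (Complex.I • X b))
    (V₁ V₄ : Matrix.specialUnitaryGroup (Fin 2) ℂ) (b₁ b₂ b₃ b₄ : PBond (F.P K) 0) :
    ((U₁ b₁ * (V₁ * U₁ b₂ * V₁⁻¹) * ((V₄ * U₁ b₃ * V₄⁻¹)⁻¹ * (U₁ b₄)⁻¹) : Matrix.specialUnitaryGroup (Fin 2) ℂ) : Matrix (Fin 2) (Fin 2) ℂ)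
      = exp (Complex.I • X b₁) * exp (Complex.I • ((V₁ : Matrix (Fin 2) (Fin 2) ℂ) * X b₂ * star (V₁ : Matrix (Fin 2) (Fin 2) ℂ)))
          * exp (Complex.I • (-((V₄ : Matrix (Fin 2) (Fin 2) ℂ) * X b₃ * star (V₄ : Matrix (Fin 2) (Fin 2) ℂ))))
          * exp (Complex.I • (-X b₄)) := by
  have e2 : ((V₁ * U₁ b₂ * V₁⁻¹ : Matrix.specialUnitaryGroup (Fin 2) ℂ) : Matrix (Fin 2) (Fin 2) ℂ)
      = exp (Complex.I • ((V₁ : Matrix (Fin 2) (Fin 2) ℂ) * X b₂ * star (V₁ : Matrix (Fin 2) (Fin 2) ℂ))) := by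
    rw [Submonoid.coe_mul, Submonoid.coe_mul, coe_su_inv, hU₁]; exact conj_exp_I_smul V₁ (X b₂)
  have h3 : ((V₄ : Matrix (Fin 2) (Fin 2) ℂ) * X b₃ * star (V₄ : Matrix (Fin 2) (Fin 2) ℂ)).IsHermitian := by
    rw [Matrix.star_eq_conjTranspose]; exact Matrix.isHermitian_mul_mul_conjTranspose _ (hX b₃).1
  have e3 : (((V₄ * U₁ b₃ * V₄⁻¹)⁻¹ : Matrix.specialUnitaryGroup (Fin 2) ℂ) : Matrix (Fin 2) (Fin 2) ℂ)
      = exp (Complex.I • (-((V₄ : Matrix (Fin 2) (Fin 2) ℂ) * X b₃ * star (V₄ : Matrix (Fin 2) (Fin 2) ℂ)))) := by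
    rw [coe_su_inv, Submonoid.coe_mul, Submonoid.coe_mul, coe_su_inv, hU₁, conj_exp_I_smul, star_exp_I_smul h3]
  have e4 : (((U₁ b₄)⁻¹ : Matrix.specialUnitaryGroup (Fin 2) ℂ) : Matrix (Fin 2) (Fin 2) ℂ) = exp (Complex.I • (-X b₄)) := by
    rw [coe_su_inv, hU₁, star_exp_I_smul (hX b₄).1]
  rw [Submonoid.coe_mul, Submonoid.coe_mul, hU₁ b₁, e2, Submonoid.coe_mul, e3, e4]
  simp only [mul_assoc]

/-- **`Ad(y⁻¹)` COMMUTES WITH THE FOUR-FACTOR FUNCTION** of `Prop7ExpLipschitz`: for a unit `y` of `M₂(ℂ)` and exponents `Z₁…Z₄`,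
`y⁻¹·[e^{iZ₁}e^{iZ₂}e^{−iZ₃}e^{−iZ₄} − 1 − i(Z₁ + Z₂ − Z₃ − Z₄)]·y` is the same expression in the transported exponents `y⁻¹Zⱼy` — used with
`y = U₀(x−e_ν, x)` unitary (parallel transport is an algebra automorphism commuting with `exp`). [cite: Balaban1985RegularSpaces, (1.1) p.76, (1.47) p.84] -/
theorem conj_plaq4_eq (g : Matrix.unitaryGroup (Fin 2) ℂ) (Z₁ Z₂ Z₃ Z₄ : Matrix (Fin 2) (Fin 2) ℂ) :
    (g : Matrix (Fin 2) (Fin 2) ℂ) * (exp (Complex.I • Z₁) * exp (Complex.I • Z₂) * exp (Complex.I • (-Z₃)) * exp (Complex.I • (-Z₄)) - 1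
        - Complex.I • (Z₁ + Z₂ - Z₃ - Z₄)) * star (g : Matrix (Fin 2) (Fin 2) ℂ)
      = exp (Complex.I • ((g : Matrix (Fin 2) (Fin 2) ℂ) * Z₁ * star (g : Matrix (Fin 2) (Fin 2) ℂ)))
          * exp (Complex.I • ((g : Matrix (Fin 2) (Fin 2) ℂ) * Z₂ * star (g : Matrix (Fin 2) (Fin 2) ℂ)))
          * exp (Complex.I • (-((g : Matrix (Fin 2) (Fin 2) ℂ) * Z₃ * star (g : Matrix (Fin 2) (Fin 2) ℂ))))
          * exp (Complex.I • (-((g : Matrix (Fin 2) (Fin 2) ℂ) * Z₄ * star (g : Matrix (Fin 2) (Fin 2) ℂ)))) - 1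
        - Complex.I • ((g : Matrix (Fin 2) (Fin 2) ℂ) * Z₁ * star (g : Matrix (Fin 2) (Fin 2) ℂ) + (g : Matrix (Fin 2) (Fin 2) ℂ) * Z₂ * star (g : Matrix (Fin 2) (Fin 2) ℂ)
            - (g : Matrix (Fin 2) (Fin 2) ℂ) * Z₃ * star (g : Matrix (Fin 2) (Fin 2) ℂ) - (g : Matrix (Fin 2) (Fin 2) ℂ) * Z₄ * star (g : Matrix (Fin 2) (Fin 2) ℂ)) := by
  set u : Matrix (Fin 2) (Fin 2) ℂ := (g : Matrix (Fin 2) (Fin 2) ℂ)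
  have hu : star u * u = 1 := Matrix.mem_unitaryGroup_iff'.mp g.2
  have hc : ∀ Z : Matrix (Fin 2) (Fin 2) ℂ, exp (Complex.I • (u * Z * star u)) = u * exp (Complex.I • Z) * star u := fun Z => by
    have h := T4AdjointCovarianceUnitary.exp_conj_unitary g (Complex.I • Z)
    rw [mul_smul_comm, smul_mul_assoc] at h
    exact h
  have hn : ∀ Z : Matrix (Fin 2) (Fin 2) ℂ, -(u * Z * star u) = u * (-Z) * star u := fun Z => by rw [mul_neg, neg_mul]
  rw [hn, hn, hc, hc, hc, hc]
  -- insert `star u * u = 1` between the factors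
  have e : u * exp (Complex.I • Z₁) * star u * (u * exp (Complex.I • Z₂) * star u) * (u * exp (Complex.I • (-Z₃)) * star u)
        * (u * exp (Complex.I • (-Z₄)) * star u)
      = u * (exp (Complex.I • Z₁) * (star u * u) * exp (Complex.I • Z₂) * (star u * u) * exp (Complex.I • (-Z₃)) * (star u * u)
          * exp (Complex.I • (-Z₄))) * star u := by
    simp only [mul_assoc]
  rw [e, hu, mul_one, mul_one, mul_one]
  have e1 : u * (1 : Matrix (Fin 2) (Fin 2) ℂ) * star u = 1 := by
    rw [mul_one]; exact Matrix.mem_unitaryGroup_iff.mp g.2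
  simp only [mul_sub, sub_mul, mul_add, add_mul, smul_sub, smul_add, mul_smul_comm, smul_mul_assoc, e1, mul_assoc]

end Letters

/-! ## §3 The background's plaquettes in every orientation, and the four transport estimates -/

section Transport

variable {F : T3ContinuumYM3Torus.T3Family} {K : ℕ}

/-- **`|U₀(∂(x; κ, μ)) − 1| < a` FOR EVERY INDEX PAIR** from `PlaqSmall a U₀` (positively oriented plaquettes): the negative orientation is the inverse
holonomy (`dist1_inv`), the degenerate word `κ = μ` is trivial. [cite: Balaban1985Variational, (2) p.278; Balaban1985Averaging, (9) p.19] -/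
theorem norm_coe_holT_plaqWord_sub_one_lt {a : ℝ} (ha : 0 < a) {U₀ : GaugeField (F.P K) 0 (Matrix.specialUnitaryGroup (Fin 2) ℂ)}
    (hU₀ : PlaqSmall a U₀) (x : Site (F.P K) 0) (κ μ : Fin (F.P K).d) :
    ‖((holT U₀ x (plaqWord κ μ) : Matrix.specialUnitaryGroup (Fin 2) ℂ) : Matrix (Fin 2) (Fin 2) ℂ) - 1‖ < a := by
  rcases lt_trichotomy κ μ with h | h | h
  · rw [holT_plaqWord_eq_plaqHol U₀ ⟨x, κ, μ, h⟩]; exact hU₀ _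
  · subst h
    rw [holT_plaqWord, mul_inv_cancel_right, mul_inv_cancel]
    simp [ha]
  · rw [holT_plaqWord_swap, holT_plaqWord_eq_plaqHol U₀ ⟨x, μ, κ, h⟩]
    have := hU₀ ⟨x, μ, κ, h⟩
    rw [← GaugeGroup.dist1_inv] at this
    exact this

/-- Unitary conjugation is isometric: `‖u^* G u‖ = ‖G‖` for `u ∈ SU(2)`. [folklore] -/
theorem norm_star_mul_mul (u : Matrix.specialUnitaryGroup (Fin 2) ℂ) (G : Matrix (Fin 2) (Fin 2) ℂ) :
    ‖star (u : Matrix (Fin 2) (Fin 2) ℂ) * G * (u : Matrix (Fin 2) (Fin 2) ℂ)‖ = ‖G‖ := by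
  have hu : (u : Matrix (Fin 2) (Fin 2) ℂ) ∈ unitary (Matrix (Fin 2) (Fin 2) ℂ) := u.2.1
  rw [CStarRing.norm_mul_mem_unitary _ hu, CStarRing.norm_mem_unitary_mul _ (Unitary.star_mem hu)]

/-- Unitary conjugation is isometric: `‖u G u^*‖ = ‖G‖` for `u ∈ SU(2)` (local copy, cf. `SmoothLiftInterp.norm_conj_eq`). [folklore] -/
private theorem norm_mul_mul_star (u : Matrix.specialUnitaryGroup (Fin 2) ℂ) (G : Matrix (Fin 2) (Fin 2) ℂ) :
    ‖(u : Matrix (Fin 2) (Fin 2) ℂ) * G * star (u : Matrix (Fin 2) (Fin 2) ℂ)‖ = ‖G‖ := by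
  have hu : (u : Matrix (Fin 2) (Fin 2) ℂ) ∈ unitary (Matrix (Fin 2) (Fin 2) ℂ) := u.2.1
  rw [CStarRing.norm_mul_mem_unitary _ (Unitary.star_mem hu), CStarRing.norm_mem_unitary_mul _ hu]

/-- **TRANSPORT OF A PLAIN EXPONENT** (`Z₁ = X(x,α)`, `Z₄ = X(x,β)`): `‖U₀(x′,ν)^*·X(x′,α)·U₀(x′,ν) − X(x,α)‖ = |(∇¹_{U₀}X)_{να}(x′)|`, `x′ = x − e_ν` — the
(19) gradient entry itself. [cite: Balaban1985RegularSpaces, (1.1) p.76; Balaban1985Variational, (19) p.281] -/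
theorem norm_transport_plain (U₀ : GaugeField (F.P K) 0 (Matrix.specialUnitaryGroup (Fin 2) ℂ)) (X : PBond (F.P K) 0 → Matrix (Fin 2) (Fin 2) ℂ)
    (x : Site (F.P K) 0) (ν α : Fin (F.P K).d) :
    ‖star ((U₀ ⟨x.unshift ν, ν⟩ : Matrix.specialUnitaryGroup (Fin 2) ℂ) : Matrix (Fin 2) (Fin 2) ℂ) * X ⟨x.unshift ν, α⟩
        * ((U₀ ⟨x.unshift ν, ν⟩ : Matrix.specialUnitaryGroup (Fin 2) ℂ) : Matrix (Fin 2) (Fin 2) ℂ) - X ⟨x, α⟩‖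
      = ‖covGradT 1 (bgUnits F K U₀) X ν α (x.unshift ν)‖ := by
  set w : Matrix (Fin 2) (Fin 2) ℂ := ((U₀ ⟨x.unshift ν, ν⟩ : Matrix.specialUnitaryGroup (Fin 2) ℂ) : Matrix (Fin 2) (Fin 2) ℂ) with hw
  have hww : star w * w = 1 := Matrix.mem_unitaryGroup_iff'.mp (U₀ ⟨x.unshift ν, ν⟩).2.1
  rw [Prop7B8Prop7Plaq.covGradT_one_bgUnits_eq, Site.shift_unshift]
  have e : star w * X ⟨x.unshift ν, α⟩ * w - X ⟨x, α⟩ = -(star w * (w * X ⟨x, α⟩ * star w - X ⟨x.unshift ν, α⟩) * w) := by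
    have h1 : star w * (w * X ⟨x, α⟩ * star w) * w = (star w * w) * X ⟨x, α⟩ * (star w * w) := by noncomm_ring
    rw [mul_sub, sub_mul, h1, hww, one_mul, mul_one]
    abel
  rw [e, norm_neg, hw, norm_star_mul_mul]

/-- **TRANSPORT OF A CONJUGATED EXPONENT** (`Z₂ = U₀(x,α)X(x+e_α,β)U₀(x,α)^*`, and `Z₃` with `α ↔ β`):
`‖U₀(x′,ν)^*·Z₂(x′)·U₀(x′,ν) − Z₂(x)‖ ≤ |(∇¹_{U₀}X)_{νβ}(x′ + e_α)| + 2|U₀(∂(x′; α, ν)) − 1|·|X(x + e_α, β)|` — commuting the two transports costs the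
background plaquette through the group identity `U₀(x′,ν)⁻¹U₀(x′,α)U₀(x′+e_α,ν) = [U₀(x′,ν)⁻¹U₀(∂(x′;α,ν))U₀(x′,ν)]·U₀(x,α)`.
[cite: Balaban1985RegularSpaces, (1.1) p.76, (1.47) p.84; Balaban1985BackgroundPropagators, (3.3) p.391] -/
theorem norm_transport_conj_le (U₀ : GaugeField (F.P K) 0 (Matrix.specialUnitaryGroup (Fin 2) ℂ)) (X : PBond (F.P K) 0 → Matrix (Fin 2) (Fin 2) ℂ)
    (x : Site (F.P K) 0) (ν α β : Fin (F.P K).d) :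
    ‖star ((U₀ ⟨x.unshift ν, ν⟩ : Matrix.specialUnitaryGroup (Fin 2) ℂ) : Matrix (Fin 2) (Fin 2) ℂ)
          * (((U₀ ⟨x.unshift ν, α⟩ : Matrix.specialUnitaryGroup (Fin 2) ℂ) : Matrix (Fin 2) (Fin 2) ℂ) * X ⟨(x.unshift ν).shift α, β⟩
              * star ((U₀ ⟨x.unshift ν, α⟩ : Matrix.specialUnitaryGroup (Fin 2) ℂ) : Matrix (Fin 2) (Fin 2) ℂ))
          * ((U₀ ⟨x.unshift ν, ν⟩ : Matrix.specialUnitaryGroup (Fin 2) ℂ) : Matrix (Fin 2) (Fin 2) ℂ)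
        - ((U₀ ⟨x, α⟩ : Matrix.specialUnitaryGroup (Fin 2) ℂ) : Matrix (Fin 2) (Fin 2) ℂ) * X ⟨x.shift α, β⟩
            * star ((U₀ ⟨x, α⟩ : Matrix.specialUnitaryGroup (Fin 2) ℂ) : Matrix (Fin 2) (Fin 2) ℂ)‖
      ≤ ‖covGradT 1 (bgUnits F K U₀) X ν β ((x.unshift ν).shift α)‖
        + 2 * ‖((holT U₀ (x.unshift ν) (plaqWord α ν) : Matrix.specialUnitaryGroup (Fin 2) ℂ) : Matrix (Fin 2) (Fin 2) ℂ) - 1‖ * ‖X ⟨x.shift α, β⟩‖ := by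
  -- group elements
  set gw := U₀ ⟨x.unshift ν, ν⟩ with hgw
  set gv := U₀ ⟨x, α⟩ with hgv
  set gv' := U₀ ⟨x.unshift ν, α⟩ with hgv'
  set gw₂ := U₀ ⟨(x.unshift ν).shift α, ν⟩ with hgw₂
  set gR := gw⁻¹ * holT U₀ (x.unshift ν) (plaqWord α ν) * gw with hgR
  have hx : ((x.unshift ν).shift α).shift ν = x.shift α := by rw [Site.shift_comm, Site.shift_unshift]
  -- the group identity: `w⁻¹ v′ w₂ = R v`
  have hgrp : gw⁻¹ * gv' * gw₂ = gR * gv := by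
    rw [hgR, holT_plaqWord, Site.shift_unshift, ← hgw, ← hgv, ← hgv', ← hgw₂]
    group
  -- matrices
  set w : Matrix (Fin 2) (Fin 2) ℂ := (gw : Matrix (Fin 2) (Fin 2) ℂ)
  set v : Matrix (Fin 2) (Fin 2) ℂ := (gv : Matrix (Fin 2) (Fin 2) ℂ)
  set v' : Matrix (Fin 2) (Fin 2) ℂ := (gv' : Matrix (Fin 2) (Fin 2) ℂ)
  set w₂ : Matrix (Fin 2) (Fin 2) ℂ := (gw₂ : Matrix (Fin 2) (Fin 2) ℂ)
  set R : Matrix (Fin 2) (Fin 2) ℂ := (gR : Matrix (Fin 2) (Fin 2) ℂ)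
  set X₂ : Matrix (Fin 2) (Fin 2) ℂ := X ⟨x.shift α, β⟩
  set G : Matrix (Fin 2) (Fin 2) ℂ := covGradT 1 (bgUnits F K U₀) X ν β ((x.unshift ν).shift α) with hG
  have hGe : G = w₂ * X₂ * star w₂ - X ⟨(x.unshift ν).shift α, β⟩ := by
    rw [hG, Prop7B8Prop7Plaq.covGradT_one_bgUnits_eq, hx]
  have hX' : X ⟨(x.unshift ν).shift α, β⟩ = w₂ * X₂ * star w₂ - G := by rw [hGe]; abel
  have hmat : star w * v' * w₂ = R * v := by
    have h := congrArg (fun g : Matrix.specialUnitaryGroup (Fin 2) ℂ => (g : Matrix (Fin 2) (Fin 2) ℂ)) hgrp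
    simp only [Submonoid.coe_mul, coe_su_inv] at h
    exact h
  -- rewrite the transported term
  have e : star w * (v' * X ⟨(x.unshift ν).shift α, β⟩ * star v') * w - v * X₂ * star v
      = ((R * v) * X₂ * star (R * v) - v * X₂ * star v) - (star w * v') * G * star (star w * v') := by
    rw [hX', ← hmat]
    simp only [star_mul, star_star, mul_sub, sub_mul]
    noncomm_ring
  rw [e]
  have n1 : ‖(R * v) * X₂ * star (R * v) - v * X₂ * star v‖ ≤ 2 * ‖R - 1‖ * ‖v * X₂ * star v‖ := by
    have e1 : (R * v) * X₂ * star (R * v) = R * (v * X₂ * star v) * star R := by rw [star_mul]; noncomm_ring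
    rw [e1]
    exact norm_conj_sub_self_le' gR _
  have n2 : ‖(star w * v') * G * star (star w * v')‖ = ‖G‖ := by
    rw [show star w * v' = (((gw⁻¹ * gv' : Matrix.specialUnitaryGroup (Fin 2) ℂ)) : Matrix (Fin 2) (Fin 2) ℂ) by
      rw [Submonoid.coe_mul, coe_su_inv]]
    exact norm_mul_mul_star _ _
  have n3 : ‖v * X₂ * star v‖ = ‖X₂‖ := norm_mul_mul_star gv _
  have n4 : ‖R - 1‖ = ‖((holT U₀ (x.unshift ν) (plaqWord α ν) : Matrix.specialUnitaryGroup (Fin 2) ℂ) : Matrix (Fin 2) (Fin 2) ℂ) - 1‖ := by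
    have : R - 1 = star w * (((holT U₀ (x.unshift ν) (plaqWord α ν) : Matrix.specialUnitaryGroup (Fin 2) ℂ) : Matrix (Fin 2) (Fin 2) ℂ) - 1) * w := by
      have hww : star w * w = 1 := Matrix.mem_unitaryGroup_iff'.mp gw.2.1
      show ((gR : Matrix.specialUnitaryGroup (Fin 2) ℂ) : Matrix (Fin 2) (Fin 2) ℂ) - 1 = _
      rw [hgR, Submonoid.coe_mul, Submonoid.coe_mul, coe_su_inv, mul_sub, sub_mul, mul_one, hww]
    rw [this, norm_star_mul_mul]
  calc _ ≤ ‖(R * v) * X₂ * star (R * v) - v * X₂ * star v‖ + ‖(star w * v') * G * star (star w * v')‖ := norm_sub_le _ _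
    _ ≤ 2 * ‖R - 1‖ * ‖v * X₂ * star v‖ + ‖G‖ := add_le_add n1 n2.le
    _ = ‖G‖ + 2 * ‖((holT U₀ (x.unshift ν) (plaqWord α ν) : Matrix.specialUnitaryGroup (Fin 2) ℂ) : Matrix (Fin 2) (Fin 2) ℂ) - 1‖ * ‖X₂‖ := by
        rw [n3, n4]; ring

end Transport

end Summit.QuantumFields.YangMills.Theorems.Prop7B8Prop7DivAlg

end
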